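import Summits.ValiantsHypothesis.ValiantsHypothesis.Theorems.LacunarySymmetroidMatrixDescartesCensusAtomM5K5EB61
import Summits.ValiantsHypothesis.ValiantsHypothesis.Theorems.LacunarySymmetroidMatrixDescartesCensusAtomM5K4QF40
import Summits.ValiantsHypothesis.ValiantsHypothesis.Theorems.LacunarySymmetroidMatrixDescartesCensusAtomM5K3S53
import Summits.ValiantsHypothesis.ValiantsHypothesis.Theorems.LacunarySymmetroidMatrixDescartesCensusRowLawM4

/-!
# `MatrixDescartes` census — THE `m = 5` ROW LAW: `ζ_sym(5,K) > P(5,K) = 15K − 25` for EVERY `K ≥ 4`, by a periodic block ladder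

HONEST FRAMING.  Experiment cell `val-V1-extremal`, width seat val-v1x-eng-9 g3 (`--supports stmt-ValiantsHypothesis-18050 --as helper`).
LOWER-bound / construction mathematics in census (CONJECTURE-A) currency: explicit real symmetric lacunary `5 × 5` pencils with many distinct
positive determinant roots, for every number of letters `K`.  It proves NOTHING about the crux `Theses.LacunarySymmetroid.MatrixDescartes`
(stmt-ValiantsHypothesis-18050 — an UPPER bound `2^{C K log K}` in the window `K^{1+o(1)} ≤ m ≤ 2^{polylog K}`; a fixed-`m` row is polynomial in
`K` and sits far below it), nothing about `DoorA26` / `DoorA34`, nothing about `VP ≠ VNP`; VP ≠ VNP is NOT proved.  No definitions, no `sorry`.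

THE LAW.  `P(m,K) = K·m(m+1)/2 − m²` is the parameter count of the format (`P(5,K) = 15K − 25`).  The cell's kernel had, at `m = 5`, the numeral rows
`K ≤ 13` and two all-`K` laws, both of slope below the `P`-slope `15` per letter (`VSQ.gen_law`: `13K − 25`; the `P4` chain ladder
`Chain.not_posRootLawAt_ladder_add`: slope `35/3`).  This file proves, for EVERY `K ≥ 4`,

  **`rowLaw : ¬ PosRootLawAt 5 K (15·K − 25)`**, i.e. `ζ_sym(5,K) ≥ P(5,K) + 1`,

and along `K ≡ 1 (mod 4)` the excess over `P` grows without bound: `ζ_sym(5, 4j+5) ≥ 61(j+1) = P + j + 11` (`row_one`, `rowLaw_excess`).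
So `m = 5` joins `m = 2, 3` (eng-6's `VSQ` laws `4K − 7 > 3K − 4`, `7K − 13 > 6K − 9`) as a row whose located constructions beat the parameter count at
every `K`, with `K`-slope `61/4 = 15.25 > 15` — the first such row with `m ≥ 4` in the tree.  (At `m = 4` the companion file `…CensusRowLawM4` gives
`ζ_sym(4,K) > P(4,K)` with BOUNDED excess, slope exactly `10 = P`-slope; for `m ≥ 6` every atom of record is sub-`P`-slope — no such law is claimed there.)

MECHANISM (bookkeeping over kernel-certified blocks; no explicit chained pencil is ever written).  The period is val-v1x-eng-2 g2's record row
`ENDBOTH61` (`(5,5) ≥ 61`: a kit-born `(5,3)` native with quadric-seeded flags on both ends; kernel `…CensusM5K5EB61`, two codes in the cell's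
`CERTS.tsv`), packaged as the block `Reflect.AtomM5K5EB61.block` (5 letters, 61 alternations, END INERTIAS bottom `(3,2)`, top `(2,3)`; val-v1x-eng-8 g3's
block kit `…CensusReflectBlocks{,Canon}`).  Since top ≠ bottom inertia, the ladder alternates the block with its negative: `E ▹ E⁻ ▹ E ▹ E⁻ ▹ …`
(`Chain.chain_append`, the tree's junction law for MATCHING JUNCTION INERTIA, seat val-sym-mdr-p1 `…ChainInertia` / `…ChainBlocks`): `q` periods give
`4q + 1` letters and `61q` alternations (`chainE` / `chainO` by parity of `q`, top form `(2,3)` resp. `(3,2)`).  The residues of `K − 1 (mod 4)` are served by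
terminal pieces whose bottom inertia matches the free end: one grafted letter (`+5`, graft law), the census native `S-5-3` block `AtomM5K3S53` (`+2` letters,
`+20`; inertias `(2,3)/(2,3)`, or its negative), eng-2's `QUADFLAG40` block `AtomM5K4QF40` (`+3` letters, `+40`; `(3,2)/(3,2)`, or its negative); `K = 4` is
`QUADFLAG40` itself (inline; `mono` = `RowLawM4.mono`).  Per residue: `K = 4j+5: 61(j+1)`; `4j+6: 61(j+1) + 5`; `4j+7: 61(j+1) + 20`; `4j+8: 61(j+1) + 40` — each `≥ 15K − 24`.
NEW NUMERAL CELLS that drop out (kernel values before this file in brackets): `(5,7) ≥ 81 [80 = P]`, `(5,8) ≥ 101 [98]`, `(5,11) ≥ 142 [138]`,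
`(5,12) ≥ 162 [156]`, `(5,13) ≥ 183 [174]`, and onwards for every `K`.
Credits: period row val-v1x-eng-2 g2; block kit + atom bank val-v1x-eng-8 g3; junction / ladder calculus val-sym-mdr-p1; natives pub-symmetroid engine-1 / lead.
[folklore] throughout (Sylvester's law of inertia, intermediate value theorem, dominant geometric rate — all inside the cited tree lemmas).
-/

-- `Summit.ValiantsHypothesis.ValiantsHypothesis.…` repeats a component by the D-0017 layout
-- (single-conjunct summit), which the `dupNamespace` linter flags; the name is mandated.
set_option linter.dupNamespace false

namespace Summit.ValiantsHypothesis.ValiantsHypothesis.Theorems.LacunarySymmetroidMatrixDescartes.Census.Reflect.RowLawM5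

open Summit.ValiantsHypothesis.ValiantsHypothesis.Theorems.MatrixDescartes.Negative (PosRootLawAt)
open Summit.ValiantsHypothesis.ValiantsHypothesis.Theorems.LacunarySymmetroidMatrixDescartes.Census
open Summit.ValiantsHypothesis.ValiantsHypothesis.Theorems.LacunarySymmetroidMatrixDescartes.Census.Reflect
open Summit.ValiantsHypothesis.ValiantsHypothesis.Theorems.LacunarySymmetroidMatrixDescartes.Census.Reflect.RowLawM4 (mono)
open scoped BigOperators Matrix

/-! ### The periodic ladder `E ▹ E⁻ ▹ E ▹ …` (`E = AtomM5K5EB61`) -/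

/-- **Even ladder**: `2q + 1` copies of `ENDBOTH61` (alternately negated) — a chain with `8q + 5` letters, `122q + 61` alternations and top
Sylvester form of inertia `(2,3)`. [folklore] -/
theorem chainE (q : ℕ) : ∃ (d : Fin (8 * q + 4 + 1) → ℕ) (S : Fin (8 * q + 4 + 1) → Matrix (Fin 5) (Fin 5) ℝ)
      (τ : Fin (122 * q + 61 + 1) → ℝ),
    StrictMono d ∧ (∀ h1 : 0 < 8 * q + 4 + 1, ∃ C : Matrix (Fin 5) (Fin 5) ℝ, C.det ≠ 0 ∧
      Cᵀ * S ⟨8 * q + 4 + 1 - 1, Nat.sub_lt h1 one_pos⟩ * C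
        = Matrix.diagonal (![(1 : ℝ), (1 : ℝ), (-1 : ℝ), (-1 : ℝ), (-1 : ℝ)] : Fin 5 → ℝ)) ∧
    (∀ l, (S l).IsSymm) ∧ StrictMono τ ∧ (∀ j, 0 < τ j) ∧ (∀ j, (∑ l, τ j ^ d l • S l).det ≠ 0) ∧
    ∀ j : Fin (122 * q + 61), (∑ l, τ j.castSucc ^ d l • S l).det * (∑ l, τ j.succ ^ d l • S l).det < 0 := by
  induction q with
  | zero =>
    exact Chain.certificateT_transport (by norm_num) (by norm_num) (Chain.chain_of_block AtomM5K5EB61.block)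
  | succ q ih =>
    -- append `E⁻` (bottom inertia `(2,3)` = the chain's top) …
    have h1 := Chain.chain_append (K₁ := 8 * q + 4) (K₂ := 4) (by norm_num) ih AtomM5K5EB61.blockNeg
      (Equiv.refl (Fin 5)) (by intro i; fin_cases i <;> norm_num)
    -- … then `E` (bottom inertia `(3,2)` = the new top)
    have h2 := Chain.chain_append (K₁ := 8 * q + 8) (K₂ := 4) (by norm_num)
      (Chain.certificateT_transport (by ring) rfl h1) AtomM5K5EB61.block
      (Equiv.refl (Fin 5)) (by intro i; fin_cases i <;> norm_num)
    exact Chain.certificateT_transport (by ring) (by ring) h2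

/-- **Odd ladder**: `2q + 2` copies — a chain with `8q + 9` letters, `122q + 122` alternations and top form of inertia `(3,2)`. [folklore] -/
theorem chainO (q : ℕ) : ∃ (d : Fin (8 * q + 8 + 1) → ℕ) (S : Fin (8 * q + 8 + 1) → Matrix (Fin 5) (Fin 5) ℝ)
      (τ : Fin (122 * q + 122 + 1) → ℝ),
    StrictMono d ∧ (∀ h1 : 0 < 8 * q + 8 + 1, ∃ C : Matrix (Fin 5) (Fin 5) ℝ, C.det ≠ 0 ∧
      Cᵀ * S ⟨8 * q + 8 + 1 - 1, Nat.sub_lt h1 one_pos⟩ * C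
        = Matrix.diagonal (![(1 : ℝ), (1 : ℝ), (1 : ℝ), (-1 : ℝ), (-1 : ℝ)] : Fin 5 → ℝ)) ∧
    (∀ l, (S l).IsSymm) ∧ StrictMono τ ∧ (∀ j, 0 < τ j) ∧ (∀ j, (∑ l, τ j ^ d l • S l).det ≠ 0) ∧
    ∀ j : Fin (122 * q + 122), (∑ l, τ j.castSucc ^ d l • S l).det * (∑ l, τ j.succ ^ d l • S l).det < 0 := by
  have h1 := Chain.chain_append (K₁ := 8 * q + 4) (K₂ := 4) (by norm_num) (chainE q) AtomM5K5EB61.blockNeg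
    (Equiv.refl (Fin 5)) (by intro i; fin_cases i <;> norm_num)
  exact Chain.certificateT_transport (by ring) (by ring) h1

/-! ### Rows by residue of `K (mod 4)` -/

/-- **`K ≡ 1 (mod 4)`: `ζ_sym(5, 4j+5) ≥ 61(j+1)`** (`¬ PosRootLawAt 5 (4j+5) (61j+60)`; `j = 0` is `ENDBOTH61`, `j = 1` the self-chain `(5,9) ≥ 122`,
`j = 2` reads `(5,13) ≥ 183`). [folklore] -/
theorem row_one (j : ℕ) : ¬ PosRootLawAt 5 (4 * j + 5) (61 * j + 60) := by
  obtain ⟨q, rfl | rfl⟩ := Nat.even_or_odd' j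
  · have h := Chain.not_posRootLawAt_of_certificateT (by omega) (chainE q)
    rw [show 4 * (2 * q) + 5 = 8 * q + 4 + 1 by ring, show 61 * (2 * q) + 60 = 122 * q + 61 - 1 by omega]
    exact h
  · have h := Chain.not_posRootLawAt_of_certificateT (by omega) (chainO q)
    rw [show 4 * (2 * q + 1) + 5 = 8 * q + 8 + 1 by ring, show 61 * (2 * q + 1) + 60 = 122 * q + 122 - 1 by omega]
    exact h

/-- **`K ≡ 2 (mod 4)`: `ζ_sym(5, 4j+6) ≥ 61(j+1) + 5`** (one grafted letter, `+5`; `j = 0` is the ray row `(5,6) ≥ 66`). [folklore] -/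
theorem row_two (j : ℕ) : ¬ PosRootLawAt 5 (4 * j + 6) (61 * j + 65) := by
  obtain ⟨q, rfl | rfl⟩ := Nat.even_or_odd' j
  · have h := not_posRootLawAt_of_certificateT_add (by omega) (chainE q) 1
    rw [show 4 * (2 * q) + 6 = 8 * q + 4 + 1 + 1 by ring, show 61 * (2 * q) + 65 = 122 * q + 61 + 1 * 5 - 1 by omega]
    exact h
  · have h := not_posRootLawAt_of_certificateT_add (by omega) (chainO q) 1
    rw [show 4 * (2 * q + 1) + 6 = 8 * q + 8 + 1 + 1 by ring, show 61 * (2 * q + 1) + 65 = 122 * q + 122 + 1 * 5 - 1 by omega]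
    exact h

/-- **`K ≡ 3 (mod 4)`: `ζ_sym(5, 4j+7) ≥ 61(j+1) + 20`** (terminal block = the census `(5,3)` native `S-5-3`, `+20` on `+2` letters;
`j = 0` reads `(5,7) ≥ 81`, above the kernel's `80 = P(5,7)`). [folklore] -/
theorem row_three (j : ℕ) : ¬ PosRootLawAt 5 (4 * j + 7) (61 * j + 80) := by
  obtain ⟨q, rfl | rfl⟩ := Nat.even_or_odd' j
  · have h := Chain.not_posRootLawAt_of_certificateT (by omega)
      (Chain.chain_append (K₁ := 8 * q + 4) (K₂ := 2) (by norm_num) (chainE q) AtomM5K3S53.block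
        (Equiv.refl (Fin 5)) (by intro i; fin_cases i <;> norm_num))
    rw [show 4 * (2 * q) + 7 = 8 * q + 4 + 2 + 1 by ring, show 61 * (2 * q) + 80 = 122 * q + 61 + 20 - 1 by omega]
    exact h
  · have h := Chain.not_posRootLawAt_of_certificateT (by omega)
      (Chain.chain_append (K₁ := 8 * q + 8) (K₂ := 2) (by norm_num) (chainO q) AtomM5K3S53.blockNeg
        (Equiv.refl (Fin 5)) (by intro i; fin_cases i <;> norm_num))
    rw [show 4 * (2 * q + 1) + 7 = 8 * q + 8 + 2 + 1 by ring, show 61 * (2 * q + 1) + 80 = 122 * q + 122 + 20 - 1 by omega]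
    exact h

/-- **`K ≡ 0 (mod 4)`, `K ≥ 8`: `ζ_sym(5, 4j+8) ≥ 61(j+1) + 40`** (terminal block = eng-2's `QUADFLAG40`, `+40` on `+3` letters;
`j = 0` reads `(5,8) ≥ 101`, `j = 1` reads `(5,12) ≥ 162`). [folklore] -/
theorem row_zero (j : ℕ) : ¬ PosRootLawAt 5 (4 * j + 8) (61 * j + 100) := by
  obtain ⟨q, rfl | rfl⟩ := Nat.even_or_odd' j
  · have h := Chain.not_posRootLawAt_of_certificateT (by omega)
      (Chain.chain_append (K₁ := 8 * q + 4) (K₂ := 3) (by norm_num) (chainE q) AtomM5K4QF40.blockNeg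
        (Equiv.refl (Fin 5)) (by intro i; fin_cases i <;> norm_num))
    rw [show 4 * (2 * q) + 8 = 8 * q + 4 + 3 + 1 by ring, show 61 * (2 * q) + 100 = 122 * q + 61 + 40 - 1 by omega]
    exact h
  · have h := Chain.not_posRootLawAt_of_certificateT (by omega)
      (Chain.chain_append (K₁ := 8 * q + 8) (K₂ := 3) (by norm_num) (chainO q) AtomM5K4QF40.block
        (Equiv.refl (Fin 5)) (by intro i; fin_cases i <;> norm_num))
    rw [show 4 * (2 * q + 1) + 8 = 8 * q + 8 + 3 + 1 by ring, show 61 * (2 * q + 1) + 100 = 122 * q + 122 + 40 - 1 by omega]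
    exact h

/-! ### The law -/

/-- **THE `m = 5` ROW LAW.**  For every `K ≥ 4` some real symmetric `K`-letter `5 × 5` lacunary pencil has at least
`P(5,K) + 1 = 15K − 24` distinct positive determinant roots: `¬ PosRootLawAt 5 K (15K − 25)`.  A LOWER bound in census currency for one
row of the table; nothing about the crux `MatrixDescartes`. [folklore] -/
theorem rowLaw (K : ℕ) (hK : 4 ≤ K) : ¬ PosRootLawAt 5 K (15 * K - 25) := by
  rcases Nat.lt_or_ge K 5 with h4 | h5
  · obtain rfl : K = 4 := by omega
    -- `K = 4`: eng-2's `QUADFLAG40` block read as a row (`ζ_sym(5,4) ≥ 40`, `P(5,4) = 35`; the tree's `quadflag40_not_posRootLawAt_5_4_39`)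
    exact mono (Chain.not_posRootLawAt_of_block (by norm_num) AtomM5K4QF40.block) (by norm_num)
  · obtain ⟨j, r, hr, rfl⟩ : ∃ j r, r < 4 ∧ K = 4 * j + 5 + r :=
      ⟨(K - 5) / 4, (K - 5) % 4, Nat.mod_lt _ (by norm_num), by omega⟩
    rcases hr_cases : r with _ | _ | _ | _ | r'
    · exact mono (row_one j) (by omega)
    · exact mono (row_two j) (by omega)
    · exact mono (row_three j) (by omega)
    · exact mono (row_zero j) (by omega)
    · omega

/-- **Unbounded excess along `K ≡ 1 (mod 4)`**: `ζ_sym(5, 4j+5) ≥ P(5, 4j+5) + j + 11` (`P(5,4j+5) = 60j + 50`). [folklore] -/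
theorem rowLaw_excess (j : ℕ) : ¬ PosRootLawAt 5 (4 * j + 5) ((15 * (4 * j + 5) - 25) + (j + 10)) := by
  have h := row_one j
  rw [show (15 * (4 * j + 5) - 25) + (j + 10) = 61 * j + 60 by omega]
  exact h

/-! ### Numeral cells (census format `(m,K) ≥ B + 1` reads `¬ PosRootLawAt m K B`) -/

/-- `ζ_sym(5,7) ≥ 81` (kernel value before this file: `80 = P(5,7)`). [folklore] -/
theorem row_5_7 : ¬ PosRootLawAt 5 7 80 := row_three 0

/-- `ζ_sym(5,8) ≥ 101` (before: `98`). [folklore] -/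
theorem row_5_8 : ¬ PosRootLawAt 5 8 100 := row_zero 0

/-- `ζ_sym(5,11) ≥ 142` (before: `138`). [folklore] -/
theorem row_5_11 : ¬ PosRootLawAt 5 11 141 := row_three 1

/-- `ζ_sym(5,12) ≥ 162` (before: `156`). [folklore] -/
theorem row_5_12 : ¬ PosRootLawAt 5 12 161 := row_zero 1

/-- `ζ_sym(5,13) ≥ 183` (before: `174`). [folklore] -/
theorem row_5_13 : ¬ PosRootLawAt 5 13 182 := row_one 2

end Summit.ValiantsHypothesis.ValiantsHypothesis.Theorems.LacunarySymmetroidMatrixDescartes.Census.Reflect.RowLawM5
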